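import Literature.AlgebraicGeometry.Frobenioids.GeometricFrobenioidsProofs
import Literature.AlgebraicGeometry.Frobenioids.GeometricDivisorDataWitness
import Mathlib.FieldTheory.IsAlgClosed.AlgebraicClosure
import Mathlib.FieldTheory.IsSepClosed
import Mathlib.FieldTheory.RatFunc.AsPolynomial
import HarnessLib

/-!
# Frobenioids I, Theorem 6.2 (iv) (`Thm62iv`: Frobenius-slim / slim / Div-slim base of a geometric Frobenioid)
# HEAD-MATCHED AT DATA — PROOF-ONLY

Mochizuki, *The geometry of Frobenioids I: the general theory*, Kyushu J. Math. **62** (2008) 293–400, §6,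
Theorem 6.2 (iv), kurims text p. 111: "Then `D` is Frobenius-slim. Let `Z ⊆ G` be the subgroup of elements that
commute with some open subgroup of `G`. Then `D` is slim if and only if `Z = {1}`; `D` is Div-slim [relative to `Φ`] if
and only if, for every `1 ≠ z ∈ Z`, there exists a finite Galois extension `L ⊆ K̃` of `K` such that `z` acts
nontrivially on `Φ(L)`" (setting of Thm. 6.2, p. 110: "`V_i` … a proper normal [geometrically integral] variety over a
field `k_i`, `K_i` the function field of `V_i`, `K̃_i/K_i` a [possibly infinite] Galois extension, `G_i = Gal(K̃_i/K_i)`,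
`D_i = B(G_i)⁰`") [cite: MochizukiFrdI2008, Thm. 6.2 (iv) p.111] [cite: MochizukiFrdI2008, Thm. 6.2 p.110]
(quoted from the kurims text; the journal printing, doi:10.2206/kyushujm.62.293 pp. 389–393, has the same words with
parentheses in place of the square brackets).

PROOF-ONLY companion (cell abc-iut, block F, seat abc-iut-f-001, KEY INST59K1; FROZEN FACT-LIST row F-1105 `Thm62iv` of
abc-iut-L1-t3's `GeometricFrobenioids.lean`; 0 `def`, 0 `instance`, 0 `structure`, no notation, nothing restated; the
declaring file is imported — through abc-iut-L6-t10's `GeometricFrobenioidsProofs.lean` — never edited).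

WHAT THE KERNEL RECORDS.  `Thm62iv M` is a predicate of an interface model `M : GeometricModelFrobenioid Γ C` over free
`K ⊆ K̃`, `Γ : GeometricDivisorData K K̃`; its universal closure is FALSE as typed (abc-iut-f-045: `not_forall_thm62iv`,
the slimness criterion needs `K̃/K` Galois), and the closer of record `Thm62iv_holds` (abc-iut-L6-t10) is universal under
the printed binder `[IsGalois K K̃]`, so no theorem of the tree had `Thm62iv` as conclusion HEAD at concrete data.  This
file supplies such instance forms, all at THE constructed model `geomModelFrobenioid` (abc-iut-L6-t10,
`GeometricFrobenioidModel.lean`: the model Frobenioid `C_{K̃/K}` of Thm. 5.2 packaged with `monEquiv = refl`):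
* GENUINE BASE DATA `K = ℚ(t)` (`RatFunc ℚ`, the function field of the projective line over `ℚ`) ⊂ `K̃ = K̄`
  (`AlgebraicClosure (RatFunc ℚ)`, Galois in characteristic `0`), so `D = B(Gal(K̄/ℚ(t)))⁰` — the base about which (iv)
  speaks — is honest; and `K = 𝔽_p(t)` ⊂ `K̃ = K^sep` (`separableClosure` inside an algebraic closure) for every prime `p`;
* TOY DIVISOR CARRIER, LABELLED AS SUCH: `Γ = GeometricDivisorData.trivial K K̃` (`GeometricDivisorDataWitness.lean`: one
  prime divisor, `Φ(L) = ℤ_{≥0}`, `B(L) = 1`, `div = 0`; NOT the divisor data of `P¹` — proper normal varieties and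
  Cartier divisors are not in Mathlib);
* and the model instance for EVERY interface datum `Γ` over EVERY Galois pair (print's binders; `M` instantiated at THE
  construction, `Γ` free).

An instance-form theorem about OUR typed statement ≠ a theorem about [FrdI] in print; classical, undisputed mathematics;
nothing here bears on [IUTchIII] Cor. 3.12 or asserts anything about abc; typed ≠ proved for anything not in this file.
-/

namespace Literature.AlgebraicGeometry.Frobenioids

/-- **F-1105 at `K = ℚ(t) ⊂ K̃ = K̄`, THE model of the toy divisor carrier**: for `C_{K̄/ℚ(t)}` built from
`GeometricDivisorData.trivial ℚ(t) K̄`, the typed Thm. 6.2 (iv) HOLDS — `D = B(Gal(K̄/ℚ(t)))⁰` is Frobenius-slim; `D` is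
slim iff `Z = {1}`; `D` is Div-slim iff every `1 ≠ z ∈ Z` acts nontrivially on some `Φ(L)`, `L/K` finite Galois —
INSTANCE at genuine base data, toy divisors, every binder closed; by abc-iut-L6-t10's `Thm62iv_holds`.
[cite: MochizukiFrdI2008, Thm. 6.2 (iv) p.111] -/
theorem Thm62iv_geomModelFrobenioid_trivial_ratFunc_rat :
    Thm62iv (geomModelFrobenioid (GeometricDivisorData.trivial (RatFunc ℚ) (AlgebraicClosure (RatFunc ℚ)))) :=
  Thm62iv_holds _

/-- **F-1105 at `K = 𝔽_p(t) ⊂ K̃ = K^sep` for EVERY prime `p`, THE model of the toy divisor carrier** (positive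
characteristic; `G = Gal(K^sep/𝔽_p(t))` the absolute Galois group). [cite: MochizukiFrdI2008, Thm. 6.2 (iv) p.111] -/
theorem Thm62iv_geomModelFrobenioid_trivial_ratFunc_zmod_sepClosure (p : ℕ) [Fact p.Prime] :
    Thm62iv (geomModelFrobenioid (GeometricDivisorData.trivial (RatFunc (ZMod p))
      (separableClosure (RatFunc (ZMod p)) (AlgebraicClosure (RatFunc (ZMod p)))))) :=
  Thm62iv_holds _

/-- **F-1105 at THE model of the toy divisor carrier over EVERY Galois pair `K ⊆ K̃`** (print's "`K̃_i/K_i` a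
[possibly infinite] Galois extension"). [cite: MochizukiFrdI2008, Thm. 6.2 (iv) p.111] -/
theorem Thm62iv_geomModelFrobenioid_trivial (K : Type) [Field K] (Kt : Type) [Field Kt] [Algebra K Kt]
    [IsGalois K Kt] : Thm62iv (geomModelFrobenioid (GeometricDivisorData.trivial K Kt)) :=
  Thm62iv_holds _

/-- **F-1105 at THE constructed model `C_{K̃/K}` of EVERY interface datum `Γ`** over every Galois pair `K ⊆ K̃`: the
parameter `M` of abc-iut-L1-t3's schema instantiated at abc-iut-L6-t10's `geomModelFrobenioid Γ` (Thm. 5.2 (ii) model,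
`monEquiv = refl`). [cite: MochizukiFrdI2008, Thm. 6.2 (iv) p.111] -/
theorem Thm62iv_geomModelFrobenioid {K : Type} [Field K] {Kt : Type} [Field Kt] [Algebra K Kt] [IsGalois K Kt]
    (Γ : GeometricDivisorData K Kt) : Thm62iv (geomModelFrobenioid Γ) :=
  Thm62iv_holds _

end Literature.AlgebraicGeometry.Frobenioids
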